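import Mathlib
import Literature.NumberTheory.Transcendental.KZVolumeConjectureProofs
import Summits.KontsevichZagierPeriods.KontsevichZagierPeriods.Theorems.SoloInformedPlanarBands
import Summits.KontsevichZagierPeriods.KontsevichZagierPeriods.Theorems.SoloInformedThetaPi
import Summits.KontsevichZagierPeriods.KontsevichZagierPeriods.Theorems.SoloInformedKZSaturation
import HarnessLib
import HarnessLib.Audit

/-!
# SoloInformed — separation of poles is a theorem of the four-rule calculus (Theorem XXV)

Solo programme `solo-KontsevichZagierPeriods-informed`, session s34. The kernel form of the main
reduction of the programme,

  `soloInformed_kzp_iff_piCancellation (H₂ : SoloInformedSeparationOfPoles)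
    (hN : SoloInformedNashCubulation) (hI : SoloInformedAyoubEvInjLocTheta) :
    KontsevichZagierPeriods ↔ KZ.PiCancellation`

(`SoloInformedThetaPi.lean`), carried as its first hypothesis the statement
`SoloInformedSeparationOfPoles` (`SoloInformedVolumeCrux.lean`): *every rational integral
representation on a bounded domain in `ℝⁿ`, `n ≥ 2`, is Kontsevich–Zagier equivalent to a finite
sum of representations of the same dimension with bounded domains and bounded integrands* — the
form in which [Viu-Sos 2021, Cor. 2.2] (Hironaka's embedded resolution of the polar locus) enters
the semi-canonical reduction. This file PROVES that statement inside the calculus, with no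
resolution of singularities:

* **up** (`KZ.exists_sub_isBounded`, tree, resolution-free: sign split, region under the graph by
  Newton–Leibniz, grounding and monomial compression): `[r] ≡ [A, 1] − [B, 1]` with `A, B ⊆ ℝⁿ⁺¹`
  bounded;
* **down** (`soloInformed_boundedVolume_descent`): a bounded volume `[V, 1]`, `V ⊆ ℝ^{m+1}`, is
  `≡ Σ_C [C, L_V|_C]` over the positive-volume cells `C` of a cylindrical decomposition of `ℝᵐ`
  adapted to `V` that carry a band of `V` (`soloInformed_cell_base`: rules (1), (3) down the
  inner bands), the other pieces being null; such a `C` is bounded (its points are initial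
  segments of points of `V`) and the fibre length `L_V` is bounded on it by `(#bands) · 2M` if
  `V ⊆ B(0, M)`;
* **sign** (`KZ.of_add_of_neg_mem_levelRel`): `−[C, L] ≡ [C, −L]`.

Main results:
* `soloInformed_boundedReduction` — EVERY representation of dimension `m + 1` (no rationality, no
  boundedness assumed) is equivalent to a finite sum of representations of dimension `m + 1` with
  bounded domains and bounded integrands;
* `soloInformed_separationOfPoles : SoloInformedSeparationOfPoles` (**Theorem XXV**);
* the hypothesis `H₂` disappears from the transfer chain:
  `soloInformed_ayoubTransfer₆'/₈'/Theta₈'`, `soloInformed_kzp_iff_piSatTheta'`,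
  `soloInformed_kzp_iff_kzSat'` and
  `soloInformed_kzp_iff_piCancellation' (hN : SoloInformedNashCubulation)
    (hI : SoloInformedAyoubEvInjLocTheta) : KontsevichZagierPeriods ↔ KZ.PiCancellation`.

References: J. Viu-Sos, *A semi-canonical reduction for periods of Kontsevich–Zagier*, Int. J.
Number Theory 17 (2021), Cor. 2.2–2.3, §4 [ViuSos2021]; M. Kontsevich, D. Zagier, *Periods*
(2001), §1.2 [KontsevichZagier2001]; S. Basu, R. Pollack, M.-F. Roy, *Algorithms in Real Algebraic
Geometry* (2006), Cor. 5.7 [BasuPollackRoy2006]; J. Ayoub, *Periods and the conjectures of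
Grothendieck and Kontsevich–Zagier*, EMS Newsl. 91 (2014), §2.2 [Ayoub2014].
-/

noncomputable section

open scoped BigOperators
open MeasureTheory Set
open Literature.ModelTheory.ExponentialFields Literature.NumberTheory.Transcendental
open Literature.NumberTheory.Transcendental.KZ

namespace Summit.KontsevichZagierPeriods.KontsevichZagierPeriods.Theorems

/-! ### Down: a bounded volume is a finite sum of bounded representations one dimension down -/

/-- **Descent of a bounded volume along the bands of a cylindrical decomposition.** Let
`[V, 1]` be a volume representation of dimension `m + 1` with bounded domain. Then
`[V, 1] ≡ Σ_j [R_j]` modulo the Kontsevich–Zagier relations, for finitely many representations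
`R_j` of dimension `m` with bounded domains and bounded integrands: over a cell `C` of a
cylindrical decomposition of `ℝᵐ` adapted to `V`, the piece `[V ∩ (C × ℝ), 1]` is a relation if
`C` is null or no band over `C` lies in `V` (the piece is then contained in finitely many graphs),
and otherwise `≡ [C, L]`, `L = Σ_{bands} (ξ_j − ξ_{j-1})` the fibre length
(`soloInformed_cell_base`, rules (1), (3)); such a `C` is bounded and `0 ≤ L ≤ (#bands)·2M` on
it when `V ⊆ B(0, M)`. [Kontsevich–Zagier 2001, §1.2, rules (1), (3); Basu–Pollack–Roy 2006,
Cor. 5.7] -/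
theorem soloInformed_boundedVolume_descent {m : ℕ} (V : IntegralRep (m + 1))
    (hVb : Bornology.IsBounded V.domain) (hV1 : ∀ z ∈ V.domain, V.integrand z = 1) :
    ∃ (k : ℕ) (R : Fin k → IntegralRep m),
      (∀ j, Bornology.IsBounded (R j).domain ∧
        ∃ M : ℝ, ∀ x ∈ (R j).domain, |(R j).integrand x| ≤ M) ∧
      of V - ∑ j, of (R j) ∈ relations := by
  classical
  have hS : IsSemialgebraic ℚ V.domain := V.isSemialgebraic_domain
  have hfin : volume V.domain ≠ ⊤ := volume_ne_top_of_integrand_one V hV1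
  -- a bound for the points of the domain
  obtain ⟨M, hM0, hM⟩ : ∃ M : ℝ, 0 ≤ M ∧ ∀ z ∈ V.domain, ‖z‖ ≤ M := by
    obtain ⟨M, hM⟩ := isBounded_iff_forall_norm_le.1 hVb
    exact ⟨max M 0, le_max_right _ _, fun z hz => (hM z hz).trans (le_max_left _ _)⟩
  have hcoord : ∀ (x : Fin m → ℝ) (t : ℝ), (Fin.snoc x t : Fin (m + 1) → ℝ) ∈ V.domain →
      |t| ≤ M := fun x t ht => by
    have h := norm_le_pi_norm (Fin.snoc x t : Fin (m + 1) → ℝ) (Fin.last m)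
    rw [Fin.snoc_last, Real.norm_eq_abs] at h
    exact h.trans (hM _ ht)
  -- the adapted cylindrical decomposition and the pieces over its cells
  obtain ⟨𝒮, l, ξ, hcd, -, hξ, hmono, hcells, hfibS⟩ :=
    IsSemialgebraic.exists_cylindricalDecomposition.exists_fibre_eq
      (IsSemialgebraic.exists_cylindricalDecomposition_holds (k := ℚ)) hS
  have hpart := hcd.isPartition
  have h𝒮sa := hcd.isSemialgebraic
  let RC : {C // C ∈ 𝒮} → IntegralRep (m + 1) := fun C =>
    V.restrict (V.domain ∩ {z | Fin.init z ∈ (C : Set (Fin m → ℝ))})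
      (hS.inter (h𝒮sa C C.2).setOf_init_mem) inter_subset_left
  have e0 : of V - ∑ C ∈ 𝒮.attach, of (RC C) ∈ relations :=
    of_sub_sum_cyl_mem_relations V 𝒮 hpart RC (fun C => rfl) fun C x _ => rfl
  -- the empty representation of dimension `m`
  obtain ⟨E, hEd, hEi⟩ := exists_oneRep (n := m) (σ := (∅ : Set (Fin m → ℝ)))
    isSemialgebraic_empty (by rw [measure_empty]; exact ENNReal.zero_ne_top)
  have hErel : of E ∈ relations :=
    of_mem_relations_of_volume_eq_zero E (by rw [hEd, measure_empty])
  have hEb : Bornology.IsBounded E.domain := by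
    rw [hEd]; exact Bornology.isBounded_empty
  have hEM : ∃ M' : ℝ, ∀ x ∈ E.domain, |E.integrand x| ≤ M' :=
    ⟨0, fun x hx => by rw [hEd] at hx; exact absurd hx (notMem_empty x)⟩
  -- cell by cell
  have hcell : ∀ C : {C // C ∈ 𝒮}, ∃ ρ : IntegralRep m, Bornology.IsBounded ρ.domain ∧
      (∃ M' : ℝ, ∀ x ∈ ρ.domain, |ρ.integrand x| ≤ M') ∧ of (RC C) - of ρ ∈ relations := by
    intro C
    -- a piece with null domain is replaced by the empty representation
    have hnull : volume (RC C).domain = 0 → ∃ ρ : IntegralRep m, Bornology.IsBounded ρ.domain ∧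
        (∃ M' : ℝ, ∀ x ∈ ρ.domain, |ρ.integrand x| ≤ M') ∧ of (RC C) - of ρ ∈ relations :=
      fun h0 => ⟨E, hEb, hEM, relations.sub_mem (of_mem_relations_of_volume_eq_zero _ h0) hErel⟩
    by_cases hC0 : volume (C : Set (Fin m → ℝ)) = 0
    · exact hnull (measure_mono_null inter_subset_right (KZ.volume_setOf_init_mem_eq_zero hC0))
    obtain ⟨G, B, -, hBsub, hfibC⟩ := hfibS C C.2
    by_cases hB : B = ∅
    · -- no band of `V` over `C`: the piece lies in finitely many graphs, a null set
      refine hnull (measure_mono_null (fun z hz => ?_)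
        ((measure_biUnion_null_iff G.countable_toSet).2 fun j _ =>
          volume_graph_eq_zero (hξ C C.2 j)))
      obtain ⟨hzS, hzC⟩ := hz
      have hzC : Fin.init z ∈ (C : Set (Fin m → ℝ)) := hzC
      have ht : z (Fin.last m) ∈
          {t : ℝ | (Fin.snoc (Fin.init z) t : Fin (m + 1) → ℝ) ∈ V.domain} := by
        show Fin.snoc (Fin.init z) (z (Fin.last m)) ∈ V.domain
        rw [Fin.snoc_init_self]
        exact hzS
      rw [hfibC _ hzC, hB] at ht
      simp only [Finset.notMem_empty, iUnion_of_empty, iUnion_empty, union_empty, mem_iUnion,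
        mem_singleton_iff, exists_prop] at ht
      obtain ⟨j, hj, hjt⟩ := ht
      exact mem_iUnion₂.2 ⟨j, hj, hzC, hjt⟩
    -- bands of `V` over `C`: down to the base `[C, L]`
    obtain ⟨bL, hbLd, hbLi, hinner, hrel⟩ := soloInformed_cell_base hS hfin (h𝒮sa C C.2) hC0
      (ξ C) (hξ C C.2) (hmono C C.2) G B hBsub (hcells C C.2).2 hfibC (RC C) rfl
      fun x hx => hV1 x hx.1
    -- over `x ∈ C`, an inner band `j ∈ B` has fibre a non-empty interval inside `[-M, M]`
    have hband : ∀ x ∈ (C : Set (Fin m → ℝ)), ∀ j ∈ B,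
        (bandLower (ξ C) j x).toReal < (bandUpper (ξ C) j x).toReal ∧
        -M ≤ (bandLower (ξ C) j x).toReal ∧ (bandUpper (ξ C) j x).toReal ≤ M ∧
        ∀ t : ℝ, (bandLower (ξ C) j x).toReal < t → t < (bandUpper (ξ C) j x).toReal →
          (Fin.snoc x t : Fin (m + 1) → ℝ) ∈ V.domain := by
      intro x hx j hj
      have h0 := (hinner j hj).1
      have hl := (hinner j hj).2
      rw [bandLower_of_ne_zero (ξ C) j h0, bandUpper_of_ne_last (ξ C) j hl, EReal.toReal_coe,
        EReal.toReal_coe]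
      have hlt : ξ C (j.pred h0) x < ξ C (j.castPred hl) x := by
        apply hmono C C.2 x hx
        rw [Fin.lt_def, Fin.val_pred, Fin.coe_castPred]
        have := Fin.pos_iff_ne_zero.2 h0
        omega
      have hmem : ∀ t : ℝ, ξ C (j.pred h0) x < t → t < ξ C (j.castPred hl) x →
          (Fin.snoc x t : Fin (m + 1) → ℝ) ∈ V.domain := fun t h1 h2 =>
        hBsub j hj (snoc_mem_bandOver_iff.2 ⟨hx,
          by rw [bandLower_of_ne_zero (ξ C) j h0, EReal.coe_lt_coe_iff]; exact h1,
          by rw [bandUpper_of_ne_last (ξ C) j hl, EReal.coe_lt_coe_iff]; exact h2⟩)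
      refine ⟨hlt, ?_, ?_, hmem⟩
      · by_contra hlo
        have hlo := not_le.1 hlo
        obtain ⟨t, ht1, ht2⟩ := exists_between (lt_min hlt hlo)
        have h := abs_le.1 (hcoord x t (hmem t ht1 (lt_min_iff.1 ht2).1))
        have h' := (lt_min_iff.1 ht2).2
        linarith [h.1]
      · by_contra hup
        have hup := not_le.1 hup
        obtain ⟨t, ht1, ht2⟩ := exists_between (max_lt hlt hup)
        have h := abs_le.1 (hcoord x t (hmem t (max_lt_iff.1 ht1).1 ht2))
        have h' := (max_lt_iff.1 ht1).2
        linarith [h.2]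
    refine ⟨bL, ?_, ⟨∑ _j ∈ B, 2 * M, fun x hx => ?_⟩, hrel⟩
    · -- `C` is bounded: its points are initial segments of points of `V`
      rw [hbLd]
      refine isBounded_iff_forall_norm_le.2 ⟨M, fun x hx => ?_⟩
      obtain ⟨j, hj⟩ := Finset.nonempty_iff_ne_empty.2 hB
      obtain ⟨hlt, -, -, hmem⟩ := hband x hx j hj
      obtain ⟨t, ht1, ht2⟩ := exists_between hlt
      have hz := hM _ (hmem t ht1 ht2)
      refine (pi_norm_le_iff_of_nonneg hM0).2 fun i => ?_
      have h := norm_le_pi_norm (Fin.snoc x t : Fin (m + 1) → ℝ) (Fin.castSucc i)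
      rw [Fin.snoc_castSucc] at h
      exact h.trans hz
    · -- the fibre length is bounded by `(#bands) · 2M`
      rw [hbLd] at hx
      rw [hbLi]
      refine (Finset.abs_sum_le_sum_abs _ _).trans (Finset.sum_le_sum fun j hj => ?_)
      obtain ⟨hlt, hlo, hup, -⟩ := hband x hx j hj
      rw [abs_of_nonneg (sub_nonneg.2 hlt.le)]
      linarith
  choose ρ hρb hρM hρrel using hcell
  refine ⟨Fintype.card {C // C ∈ 𝒮}, fun j => ρ ((Fintype.equivFin {C // C ∈ 𝒮}).symm j),
    fun j => ⟨hρb _, hρM _⟩, ?_⟩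
  have hsum : ∑ j, of (ρ ((Fintype.equivFin {C // C ∈ 𝒮}).symm j)) =
      ∑ C ∈ 𝒮.attach, of (ρ C) := by
    rw [← Finset.univ_eq_attach]
    exact Equiv.sum_comp (Fintype.equivFin {C // C ∈ 𝒮}).symm (fun C => of (ρ C))
  rw [hsum]
  have hsplit : of V - ∑ C ∈ 𝒮.attach, of (ρ C) =
      (of V - ∑ C ∈ 𝒮.attach, of (RC C)) + ∑ C ∈ 𝒮.attach, (of (RC C) - of (ρ C)) := by
    rw [Finset.sum_sub_distrib]; abel
  rw [hsplit]
  exact relations.add_mem e0 (sum_mem fun C _ => hρrel C)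

/-! ### Up and down: every representation is a finite sum of bounded ones of the same dimension -/

/-- **Bounded reduction in the same dimension.** Every integral representation `r` of dimension
`m + 1` (rational or not, bounded or not) is Kontsevich–Zagier equivalent to a finite sum
`Σ_j [R_j]` of representations OF THE SAME DIMENSION with bounded domains and bounded integrands:
`[r] ≡ [A, 1] − [B, 1]` with bounded volumes one dimension up (`KZ.exists_sub_isBounded`, no
resolution of singularities), both descended along the bands of adapted cylindrical
decompositions (`soloInformed_boundedVolume_descent`), and `−[C, L] ≡ [C, −L]`
(`KZ.of_add_of_neg_mem_levelRel`). [Viu-Sos 2021, Cor. 2.2–2.3 (statement); Kontsevich–Zagier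
2001, §1.2] -/
theorem soloInformed_boundedReduction {m : ℕ} (r : IntegralRep (m + 1)) :
    ∃ (k : ℕ) (R : Fin k → IntegralRep (m + 1)),
      (∀ j, Bornology.IsBounded (R j).domain ∧
        ∃ M : ℝ, ∀ x ∈ (R j).domain, |(R j).integrand x| ≤ M) ∧
      of r - ∑ j, of (R j) ∈ relations := by
  obtain ⟨A, B, hAb, hBb, hA1, hB1, e⟩ := exists_sub_isBounded r
  obtain ⟨kA, RA, hRA, eA⟩ := soloInformed_boundedVolume_descent A hAb hA1
  obtain ⟨kB, RB, hRB, eB⟩ := soloInformed_boundedVolume_descent B hBb hB1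
  refine ⟨kA + kB, Fin.append RA fun j => (RB j).neg, fun j => ?_, ?_⟩
  · induction j using Fin.addCases with
    | left i => rw [Fin.append_left]; exact hRA i
    | right i =>
      rw [Fin.append_right]
      obtain ⟨hb, M, hM⟩ := hRB i
      exact ⟨hb, M, fun x hx => by
        rw [IntegralRep.integrand_neg, Pi.neg_apply, abs_neg]; exact hM x hx⟩
  · rw [Fin.sum_univ_add]
    simp only [Fin.append_left, Fin.append_right]
    have hneg : ∑ i : Fin kB, (of (RB i) + of (RB i).neg) ∈ relations :=
      sum_mem fun i _ => levelRel_le_relations (of_add_of_neg_mem_levelRel (RB i))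
    have hsplit : of r - (∑ i : Fin kA, of (RA i) + ∑ i : Fin kB, of (RB i).neg) =
        (of r - (of A - of B)) + (of A - ∑ i, of (RA i)) - (of B - ∑ i, of (RB i)) -
          ∑ i : Fin kB, (of (RB i) + of (RB i).neg) := by
      rw [Finset.sum_add_distrib]; abel
    rw [hsplit]
    exact relations.sub_mem (relations.sub_mem (relations.add_mem e eA) eB) hneg

/-- **Theorem XXV: separation of poles is a theorem of the calculus.** The hypothesis
`SoloInformedSeparationOfPoles` of the transfer chain — every rational representation on a bounded
domain in `ℝⁿ`, `n ≥ 2`, is equivalent to a finite sum of representations of dimension `n` with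
bounded domains and bounded integrands [Viu-Sos 2021, Cor. 2.2, there by Hironaka's embedded
resolution] — holds, by `soloInformed_boundedReduction` (which needs neither `n ≥ 2`, nor
rationality, nor boundedness). [Viu-Sos 2021, Cor. 2.2] -/
theorem soloInformed_separationOfPoles : SoloInformedSeparationOfPoles := by
  intro n hn r _ _
  obtain ⟨m, rfl⟩ : ∃ m, n = m + 1 := ⟨n - 1, by omega⟩
  exact soloInformed_boundedReduction r

/-! ### The transfer chain without the separation-of-poles hypothesis -/

/-- The volume crux alone implies the resolution statement of the Ayoub transfer
(`soloInformed_cubeResolution_of_volumes` with `H₂` discharged). [Ayoub 2014, §2.2] -/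
theorem soloInformed_cubeResolution_of_volumes' (hV : SoloInformedVolumeResolution) :
    SoloInformedAyoubCubeResolution :=
  soloInformed_cubeResolution_of_volumes soloInformed_separationOfPoles hV

/-- **The Ayoub transfer from volumes, `H₂`-free**: the volume crux and Ayoub's conjecture up to
torsion imply the Kontsevich–Zagier period conjecture. [Ayoub 2014, §2.2, Conj. 7, Prop. 11] -/
theorem soloInformed_ayoubTransfer₆' (hV : SoloInformedVolumeResolution)
    (hA : SoloInformedAyoubKZeffQ) : KontsevichZagierPeriods :=
  soloInformed_ayoubTransfer₆ soloInformed_separationOfPoles hV hA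

/-- **The Ayoub transfer from Nash cubulation, `H₂`-free.** [Ayoub 2014, §2.2] -/
theorem soloInformed_ayoubTransfer₈' (hN : SoloInformedNashCubulation)
    (hA : SoloInformedAyoubKZeffQ) : KontsevichZagierPeriods :=
  soloInformed_ayoubTransfer₈ soloInformed_separationOfPoles hN hA

/-- **Transfer chain, `H₂`-free**:
`NashCubulation → AyoubEvInjLocTheta → PiSatTheta → KontsevichZagierPeriods`.
[Ayoub 2014, §2.2, Def. 10, Prop. 11, Rem. 13] -/
theorem soloInformed_ayoubTransferTheta₈' (hN : SoloInformedNashCubulation)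
    (hI : SoloInformedAyoubEvInjLocTheta) (hS : SoloInformedPiSatTheta) :
    KontsevichZagierPeriods :=
  soloInformed_ayoubTransferTheta₈ soloInformed_separationOfPoles hN hI hS

/-- **Theorem IV, `H₂`-free**: granting Nash cubulation and Ayoub's conjecture localised at `θ₀`,
the Kontsevich–Zagier period conjecture is equivalent to the cancellation statement
`SoloInformedPiSatTheta`. [Ayoub 2014, §2.2] -/
theorem soloInformed_kzp_iff_piSatTheta' (hN : SoloInformedNashCubulation)
    (hI : SoloInformedAyoubEvInjLocTheta) : KontsevichZagierPeriods ↔ SoloInformedPiSatTheta :=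
  soloInformed_kzp_iff_piSatTheta soloInformed_separationOfPoles hN hI

/-- **Sandwich, `H₂`-free**: granting Nash cubulation and Ayoub's localised statement, the summit
is equivalent to saturation of the formal period ring, and to its integrality.
[Ayoub 2014, §2.2, Def. 10, Prop. 11, Rem. 13] -/
theorem soloInformed_kzp_iff_kzSat' (hN : SoloInformedNashCubulation)
    (hA : SoloInformedAyoubKZLoc) :
    (KontsevichZagierPeriods ↔ SoloInformedKZSat) ∧
      (KontsevichZagierPeriods ↔ SoloInformedKZDomain) :=
  soloInformed_kzp_iff_kzSat soloInformed_separationOfPoles hN hA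

/-- **THEOREM IV (final form, two hypotheses).** Granting Nash cubulation of compact
`ℚ`-semialgebraic sets and Ayoub's conjecture on symbols localised at `θ₀` (a consequence of the
Grothendieck period conjecture), **the Kontsevich–Zagier period conjecture is equivalent to
`KZ.PiCancellation`** ("if `[π]·c` is a `ℤ`-combination of the four moves then so is `c`");
separation of poles is no longer a hypothesis (`soloInformed_separationOfPoles`).
[Ayoub 2014, §2.2; Kontsevich–Zagier 2001, §1.2] -/
theorem soloInformed_kzp_iff_piCancellation' (hN : SoloInformedNashCubulation)
    (hI : SoloInformedAyoubEvInjLocTheta) : KontsevichZagierPeriods ↔ PiCancellation :=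
  soloInformed_kzp_iff_piCancellation soloInformed_separationOfPoles hN hI

/-- The transfer direction alone, `H₂`-free: `KZ.PiCancellation → KZP` under the two hypotheses.
[Ayoub 2014, §2.2] -/
theorem soloInformed_kzp_of_piCancellation' (hN : SoloInformedNashCubulation)
    (hI : SoloInformedAyoubEvInjLocTheta) (hc : PiCancellation) : KontsevichZagierPeriods :=
  (soloInformed_kzp_iff_piCancellation' hN hI).2 hc

end Summit.KontsevichZagierPeriods.KontsevichZagierPeriods.Theorems
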